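import Literature.Probability.LatticeModels.GlauberBoundaryGradientBoxStep
import Literature.Probability.LatticeModels.FatRectangleBoxes
import HarnessLib

/-!
# [Mar99] Lemma 4.8 on fat rectangles: the scale step `k_m(L'') ≤ α² k_m(L') + (α+1)γ` for `3L'' ≤ 4L'`, PROVED

Topic `Literature/Probability/LatticeModels`; cell `ym-ir`, seat lit-3 (census rows B2/B4).  Theorems only
(D-0026).  [Mar99] F. Martinelli, LNM 1717 (1999), Lemma 4.8, proof p0192 L35 – p0195 L1 (held text
`book:bertoin1999-lectures-probability-theory-statistics`), in the language of the typed facts (`d = 2`,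
`𝓡_L = fatRectangles L`, `SMT` on all fat rectangles): if every `R ∈ 𝓡_{L'}` satisfies the boundary-gradient
bound (4.27) `|∇_x √(μ_R^·(f²))|²(τ) ≤ k (μ_R^τ(|∇_x f|²) + Σ_{y∈R} e^{−m'|x−y|} μ_R^τ(|∇_y f|²))` at every `x ∉ R`
(all boundary conditions, all bounded measurable `f`), then every `R ∈ 𝓡_{L''}` with `3L'' ≤ 4L'` satisfies it
with constant `α²k + (α+1)γ`, `α = (1+t)(1+Rδ)²(1−Rδ)⁻¹`, `γ = (1+t⁻¹)(9R²δ²/g₀) ½ e^{m'(r+L'')}`, for any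
admissible `(D, δ, t)` at scale `L'` (`8(D+2) ≤ L'+1`, `l + 2r ≤ D`, `δ ≥ R³(2r+1)⁴ L''² e^{−m(D−2r)}`, `Rδ ≤ ½`)
— rectangles longer than `L'` in one direction are halved along it ((4.37), «either belongs to 𝓡_{3L/2} or …»
p0194 L3–4), those longer in both directions twice ((4.38)); `g₀` is the uniform spectral gap of Theorem 4.5
(p0194 L1).  What remains for Corollary 4.9 (`sup_L k_m(L) < ∞`): the choice `D ≈ L'/8`, `t = δ(L')`,
`m' ≤ m/32` making `α² − 1` and `(α+1)γ` summably small, and the base scale — the companion file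
`GlauberBoundaryGradientUniform`.  SIBLING-SETTING result (`±1` spins, range `r`); the Yang–Mills gap is not
touched. [cite: Martinelli1999, Lemma 4.8, proof, (4.37)–(4.38)]
-/

open MeasureTheory ProbabilityTheory Finset Filter

noncomputable section

namespace Literature.Probability.LatticeModels

namespace Glauber

variable {r : ℕ} (U : FRPotential 2 ℤˣ r) (β : ℝ)

set_option maxHeartbeats 4000000 in
/-- **[Mar99] Lemma 4.8, the scale step (4.37)–(4.38) on fat rectangles**: see the module docstring.
[cite: Martinelli1999, Lemma 4.8, proof, (4.37)–(4.38)] -/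
theorem fatRectangles_gradBound_step {Rb : ℝ} (hR1 : 1 ≤ Rb)
    (hR : ∀ (Λ : Finset (Site 2)) (y : Site 2) (σ : Site 2 → ℤˣ),
      Rb⁻¹ ≤ flipWeight U β Λ y σ ∧ flipWeight U β Λ y σ ≤ Rb)
    {lS : ℕ} {m : ℝ} (hm : 0 ≤ m) (hSMT : ∀ L : ℕ, ∀ Q ∈ fatRectangles L, SMT (U.spec β) Q lS m)
    {g₀ : ℝ} (hg₀ : 0 < g₀)
    (hgap : ∀ L : ℕ, ∀ Q ∈ fatRectangles L, ∀ τ : Site 2 → ℤˣ, PoincareIneq (U.spec β Q τ) Q g₀)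
    {k m' : ℝ} (hk : 1 ≤ k) (hm' : 0 ≤ m')
    {L' L'' D : ℕ} (hL2 : 3 * L'' ≤ 4 * L') (hD : 8 * (D + 2) ≤ L' + 1) (hlD : lS + 2 * r ≤ D) (hrD : r < D)
    {δ : ℝ} (hδ : Rb ^ 3 * (2 * r + 1 : ℝ) ^ 2 * (2 * r + 1 : ℝ) ^ 2 * ((L'' : ℝ) ^ 2) *
      Real.exp (-(m * ((D : ℝ) - 2 * r))) ≤ δ) (hδs : Rb * δ ≤ 1 / 2)
    {t : ℝ} (ht : 0 < t)
    (hGB : ∀ Q ∈ fatRectangles L', ∀ (τ : Site 2 → ℤˣ) (x : Site 2), x ∉ Q →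
      ∀ f : (Site 2 → ℤˣ) → ℝ, Measurable f → ∀ C : ℝ, (∀ σ, |f σ| ≤ C) →
        (Real.sqrt (∫ ω, f ω ^ 2 ∂(U.spec β Q (spinFlip x τ))) -
            Real.sqrt (∫ ω, f ω ^ 2 ∂(U.spec β Q τ))) ^ 2 ≤
          k * (∫ ω, siteGrad x f ω ^ 2 ∂(U.spec β Q τ) +
            ∑ y ∈ Q, Real.exp (-(m' * (supDist x y : ℝ))) * ∫ ω, siteGrad y f ω ^ 2 ∂(U.spec β Q τ))) :
    ∀ Q ∈ fatRectangles L'', ∀ (τ : Site 2 → ℤˣ) (x : Site 2), x ∉ Q →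
      ∀ f : (Site 2 → ℤˣ) → ℝ, Measurable f → ∀ C : ℝ, (∀ σ, |f σ| ≤ C) →
        (Real.sqrt (∫ ω, f ω ^ 2 ∂(U.spec β Q (spinFlip x τ))) -
            Real.sqrt (∫ ω, f ω ^ 2 ∂(U.spec β Q τ))) ^ 2 ≤
          (((1 + t) * ((1 + Rb * δ) ^ 2 * (1 - Rb * δ)⁻¹)) ^ 2 * k +
            ((1 + t) * ((1 + Rb * δ) ^ 2 * (1 - Rb * δ)⁻¹) + 1) *
              ((1 + t⁻¹) * (9 * Rb ^ 2 * δ ^ 2 / g₀) * ((1 / 2) * Real.exp (m' * (r + L''))))) *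
          (∫ ω, siteGrad x f ω ^ 2 ∂(U.spec β Q τ) +
            ∑ y ∈ Q, Real.exp (-(m' * (supDist x y : ℝ))) * ∫ ω, siteGrad y f ω ^ 2 ∂(U.spec β Q τ)) := by
  classical
  -- the property, its monotonicity
  set GB : Finset (Site 2) → ℝ → Prop := fun Q κ => ∀ (τ : Site 2 → ℤˣ) (x : Site 2), x ∉ Q →
      ∀ f : (Site 2 → ℤˣ) → ℝ, Measurable f → ∀ C : ℝ, (∀ σ, |f σ| ≤ C) →
        (Real.sqrt (∫ ω, f ω ^ 2 ∂(U.spec β Q (spinFlip x τ))) -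
            Real.sqrt (∫ ω, f ω ^ 2 ∂(U.spec β Q τ))) ^ 2 ≤
          κ * (∫ ω, siteGrad x f ω ^ 2 ∂(U.spec β Q τ) +
            ∑ y ∈ Q, Real.exp (-(m' * (supDist x y : ℝ))) * ∫ ω, siteGrad y f ω ^ 2 ∂(U.spec β Q τ))
    with hGBdef
  set α : ℝ := (1 + t) * ((1 + Rb * δ) ^ 2 * (1 - Rb * δ)⁻¹) with hα
  set γ' : ℝ := (1 + t⁻¹) * (9 * Rb ^ 2 * δ ^ 2 / g₀) * ((1 / 2) * Real.exp (m' * (r + L''))) with hγ'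
  have hR0 : 0 < Rb := by linarith
  have hδ0 : 0 ≤ δ := le_trans (by positivity) hδ
  have hRδ1 : Rb * δ < 1 := by linarith
  have h1Rδ : 1 ≤ (1 - Rb * δ)⁻¹ := by
    rw [le_inv_comm₀ one_pos (by linarith), inv_one]; nlinarith
  have hα1 : 1 ≤ α := by
    rw [hα]
    have h1 : (1 : ℝ) ≤ 1 + t := by linarith
    have h2 : (1 : ℝ) ≤ (1 + Rb * δ) ^ 2 := by nlinarith
    calc (1 : ℝ) = 1 * (1 * 1) := by ring
      _ ≤ (1 + t) * ((1 + Rb * δ) ^ 2 * (1 - Rb * δ)⁻¹) := by gcongr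
  have hα0 : 0 ≤ α := zero_le_one.trans hα1
  have hγ'0 : 0 ≤ γ' := by positivity
  have hGBmono : ∀ (Q : Finset (Site 2)) (κ κ' : ℝ), κ ≤ κ' → GB Q κ → GB Q κ' := by
    intro Q κ κ' hle h τ x hx f hf C hC
    refine (h τ x hx f hf C hC).trans (mul_le_mul_of_nonneg_right hle ?_)
    exact add_nonneg (integral_nonneg fun _ => sq_nonneg _)
      (sum_nonneg fun y _ => mul_nonneg (Real.exp_nonneg _) (integral_nonneg fun _ => sq_nonneg _))
  have hGB' : ∀ Q ∈ fatRectangles L', GB Q k := fun Q hQ => hGB Q hQ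
  show ∀ Q ∈ fatRectangles L'', GB Q (α ^ 2 * k + (α + 1) * γ')
  -- integer forms
  have hL3 : (3 : ℤ) * L'' ≤ 4 * L' := by exact_mod_cast hL2
  have hD' : (8 : ℤ) * (D + 2) ≤ L' + 1 := by exact_mod_cast hD
  have hD1 : (1 : ℤ) ≤ D := by exact_mod_cast (show 1 ≤ D by omega)
  -- the halving step for a fat box with sides `≤ L''` and `j`-side `> L'`
  have halve : ∀ (a b : Site 2) (j : Fin 2) (k₁ : ℝ), 1 ≤ k₁ → (∀ i, a i < b i) →
      (∀ i i', b i - a i ≤ 10 * (b i' - a i')) → (∀ i, b i - a i ≤ L'') → (L' : ℤ) < b j - a j →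
      (∀ s : ℤ, a j ≤ s → s + (b j - a j - (b j - a j) / 2) ≤ b j →
        GB (Fintype.piFinset fun i => Finset.Ico ((Function.update a j s) i)
          ((Function.update b j (s + (b j - a j - (b j - a j) / 2))) i)) k₁) →
      GB (Fintype.piFinset fun i => Finset.Ico (a i) (b i)) (α * k₁ + γ') := by
    intro a b j k₁ hk₁ hpos hfat hle hLj hhalves τ x hx f hf C hC
    have hQfat : (Fintype.piFinset fun i => Finset.Ico (a i) (b i)) ∈ fatRectangles L'' :=
      IcoBox_mem_fatRectangles hpos hfat hle
    have hcard : (((Fintype.piFinset fun i => Finset.Ico (a i) (b i))).card : ℝ) ≤ (L'' : ℝ) ^ 2 := by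
      rw [card_IcoBox, Fin.prod_univ_two]
      have h0 : (b 0 - a 0).toNat ≤ L'' := by have := hle 0; omega
      have h1 : (b 1 - a 1).toNat ≤ L'' := by have := hle 1; omega
      have h2 : (b 0 - a 0).toNat * (b 1 - a 1).toNat ≤ L'' * L'' := Nat.mul_le_mul h0 h1
      calc (((b 0 - a 0).toNat * (b 1 - a 1).toNat : ℕ) : ℝ) ≤ ((L'' * L'' : ℕ) : ℝ) := by exact_mod_cast h2
        _ = (L'' : ℝ) ^ 2 := by push_cast; ring
    have hδ' : Rb ^ 3 * (2 * r + 1 : ℝ) ^ 2 * (2 * r + 1 : ℝ) ^ 2 *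
        (((Fintype.piFinset fun i => Finset.Ico (a i) (b i))).card : ℝ) * Real.exp (-(m * ((D : ℝ) - 2 * r))) ≤ δ :=
      le_trans (by gcongr) hδ
    have hDℓ : 8 * ((D : ℤ) + 2) ≤ b j - a j := by linarith
    -- the sub-boxes are fat rectangles (for `SMT`)
    have hsub : ∀ s : ℤ, a j ≤ s → s + (b j - a j - (b j - a j) / 2) ≤ b j →
        SMT (U.spec β) (Fintype.piFinset fun i => Finset.Ico ((Function.update a j s) i)
          ((Function.update b j (s + (b j - a j - (b j - a j) / 2))) i)) lS m ∧
        ∀ (σ : Site 2 → ℤˣ) (x : Site 2),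
          x ∉ (Fintype.piFinset fun i => Finset.Ico ((Function.update a j s) i)
            ((Function.update b j (s + (b j - a j - (b j - a j) / 2))) i)) →
          ∀ f : (Site 2 → ℤˣ) → ℝ, Measurable f → ∀ C : ℝ, (∀ σ, |f σ| ≤ C) →
            (Real.sqrt (∫ ω, f ω ^ 2 ∂(U.spec β (Fintype.piFinset fun i => Finset.Ico ((Function.update a j s) i)
                ((Function.update b j (s + (b j - a j - (b j - a j) / 2))) i)) (spinFlip x σ))) -
              Real.sqrt (∫ ω, f ω ^ 2 ∂(U.spec β (Fintype.piFinset fun i => Finset.Ico ((Function.update a j s) i)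
                ((Function.update b j (s + (b j - a j - (b j - a j) / 2))) i)) σ))) ^ 2 ≤
            k₁ * (∫ ω, siteGrad x f ω ^ 2 ∂(U.spec β (Fintype.piFinset fun i => Finset.Ico
                ((Function.update a j s) i) ((Function.update b j (s + (b j - a j - (b j - a j) / 2))) i)) σ) +
              ∑ y ∈ (Fintype.piFinset fun i => Finset.Ico ((Function.update a j s) i)
                ((Function.update b j (s + (b j - a j - (b j - a j) / 2))) i)),
                Real.exp (-(m' * (supDist x y : ℝ))) * ∫ ω, siteGrad y f ω ^ 2 ∂(U.spec β (Fintype.piFinset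
                  fun i => Finset.Ico ((Function.update a j s) i)
                    ((Function.update b j (s + (b j - a j - (b j - a j) / 2))) i)) σ)) := by
      intro s hs1 hs2
      refine ⟨hSMT L'' _ (IcoBox_mem_fatRectangles (fun i => ?_) (fun i i' => ?_) (fun i => ?_)), hhalves s hs1 hs2⟩
      · by_cases hij : i = j
        · subst hij; rw [Function.update_self, Function.update_self]; omega
        · rw [Function.update_of_ne hij, Function.update_of_ne hij]; exact hpos i
      · by_cases hij : i = j <;> by_cases hi'j : i' = j
        · subst hij; rw [hi'j, Function.update_self, Function.update_self]; omega
        · subst hij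
          rw [Function.update_self, Function.update_self, Function.update_of_ne hi'j, Function.update_of_ne hi'j]
          have := hfat i i'
          omega
        · subst hi'j
          rw [Function.update_self, Function.update_self, Function.update_of_ne hij, Function.update_of_ne hij]
          have h1 := hle i
          omega
        · rw [Function.update_of_ne hij, Function.update_of_ne hij, Function.update_of_ne hi'j,
            Function.update_of_ne hi'j]
          exact hfat i i'
      · by_cases hij : i = j
        · subst hij; rw [Function.update_self, Function.update_self]; have := hle i; omega
        · rw [Function.update_of_ne hij, Function.update_of_ne hij]; exact hle i
    have key := sq_sqrt_sub_sqrt_le_box_of_subboxes U β hR1 hR (a := a) (b := b) (j := j) hm hk₁ hm' hg₀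
      (fun τ' => hgap L'' _ hQfat τ') hsub hDℓ hlD hrD hδ' hδs hle ht τ hx hf hC
    refine key.trans (le_of_eq ?_)
    simp only [hα, hγ']
    ring
  -- the rectangles of `𝓡_{L''}`
  intro Q hQ
  obtain ⟨a, b, rfl, hpos, hfat, hle⟩ := exists_IcoBox_of_mem_fatRectangles hQ
  have hk0 : 0 ≤ k := zero_le_one.trans hk
  have hmono1 : k ≤ α * k + γ' := by nlinarith
  have hmono2 : α * k + γ' ≤ α ^ 2 * k + (α + 1) * γ' := by nlinarith
  by_cases hsmall : ∀ i, b i - a i ≤ L'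
  · exact hGBmono _ _ _ (hmono1.trans hmono2) (hGB' _ (IcoBox_mem_fatRectangles hpos hfat hsmall))
  rw [not_forall] at hsmall
  obtain ⟨j₀, hj₀⟩ := hsmall
  rw [not_le] at hj₀
  obtain ⟨j, hlong, hLj⟩ : ∃ j : Fin 2, (∀ i, b i - a i ≤ b j - a j) ∧ (L' : ℤ) < b j - a j := by
    by_cases h01 : b 0 - a 0 ≤ b 1 - a 1
    · refine ⟨1, fun i => ?_, ?_⟩
      · fin_cases i
        · exact h01
        · exact le_rfl
      · fin_cases j₀
        · exact lt_of_lt_of_le hj₀ h01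
        · exact hj₀
    · rw [not_le] at h01
      refine ⟨0, fun i => ?_, ?_⟩
      · fin_cases i
        · exact le_rfl
        · exact h01.le
      · fin_cases j₀
        · exact hj₀
        · exact lt_trans hj₀ h01
  have hk₁ : 1 ≤ α * k + γ' := hk.trans hmono1
  refine hGBmono _ _ _ (le_of_eq (by ring)) (halve a b j (α * k + γ') hk₁ hpos hfat hle hLj ?_)
  intro s hs1 hs2
  -- the half `H = Π[a'_i, b'_i)`
  set a' : Site 2 := Function.update a j s with ha'
  set b' : Site 2 := Function.update b j (s + (b j - a j - (b j - a j) / 2)) with hb'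
  have hHj : b' j - a' j = b j - a j - (b j - a j) / 2 := by
    rw [ha', hb', Function.update_self, Function.update_self]; ring
  have hHside : ∀ i, i ≠ j → b' i - a' i = b i - a i := fun i hi => by
    rw [ha', hb', Function.update_of_ne hi, Function.update_of_ne hi]
  have hℓ2 : (b j - a j) / 2 ≤ (b j - a j) - (b j - a j) / 2 ∧ 0 ≤ (b j - a j) / 2 ∧
      2 * ((b j - a j) / 2) ≤ b j - a j ∧ b j - a j - 1 ≤ 2 * ((b j - a j) / 2) := by omega
  have hHj_le : b' j - a' j ≤ L' := by rw [hHj]; linarith [hle j, hℓ2.2.2.2]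
  have hHj_ge : (L' : ℤ) < 2 * (b' j - a' j) := by rw [hHj]; linarith [hℓ2.1, hℓ2.2.2.2]
  have hHpos : ∀ i, a' i < b' i := by
    intro i
    by_cases hi : i = j
    · rw [hi]; linarith
    · rw [ha', hb', Function.update_of_ne hi, Function.update_of_ne hi]; exact hpos i
  have hHfat : ∀ i i', b' i - a' i ≤ 10 * (b' i' - a' i') := by
    intro i i'
    by_cases hi : i = j <;> by_cases hi' : i' = j
    · rw [hi, hi']; linarith
    · rw [hi, hHside i' hi']
      have := hfat j i'
      linarith [hpos i', hℓ2.2.2.1]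
    · rw [hi', hHside i hi]
      linarith [hle i, hL3]
    · rw [hHside i hi, hHside i' hi']; exact hfat i i'
  have hHle : ∀ i, b' i - a' i ≤ L'' := by
    intro i
    by_cases hi : i = j
    · rw [hi]; linarith [hle j, hℓ2.2.2.1]
    · rw [hHside i hi]; exact hle i
  by_cases hcase : ∀ i, i ≠ j → b i - a i ≤ L'
  · -- case a): the half lies in `𝓡_{L'}`
    have hHle' : ∀ i, b' i - a' i ≤ L' := by
      intro i
      by_cases hi : i = j
      · rw [hi]; exact hHj_le
      · rw [hHside i hi]; exact hcase i hi
    exact hGBmono _ _ _ hmono1 (hGB' _ (IcoBox_mem_fatRectangles hHpos hHfat hHle'))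
  · -- case b): the other side `i` is longer than `L'`; halve `H` along `i`
    rw [not_forall] at hcase
    obtain ⟨i, hi⟩ := hcase
    rw [Classical.not_imp, not_le] at hi
    obtain ⟨hij, hLi⟩ := hi
    have hother_eq : ∀ i' : Fin 2, i' ≠ i → i' = j := by
      intro i' hi'i
      have h1 := Fin.val_ne_of_ne hi'i
      have h2 := Fin.val_ne_of_ne hij
      apply Fin.ext
      have := i.isLt; have := j.isLt; have := i'.isLt
      omega
    have hHlong_i : (L' : ℤ) < b' i - a' i := by rw [hHside i hij]; exact hLi
    refine halve a' b' i k hk hHpos hHfat hHle hHlong_i ?_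
    -- the quarters lie in `𝓡_{L'}`
    intro s' hs'1 hs'2
    set a'' : Site 2 := Function.update a' i s' with ha''
    set b'' : Site 2 := Function.update b' i (s' + (b' i - a' i - (b' i - a' i) / 2)) with hb''
    have hKi : b'' i - a'' i = b' i - a' i - (b' i - a' i) / 2 := by
      rw [ha'', hb'', Function.update_self, Function.update_self]; ring
    have hKside : ∀ i', i' ≠ i → b'' i' - a'' i' = b' i' - a' i' := fun i' hi' => by
      rw [ha'', hb'', Function.update_of_ne hi', Function.update_of_ne hi']
    have hℓi2 : (b' i - a' i) / 2 ≤ (b' i - a' i) - (b' i - a' i) / 2 ∧ 0 ≤ (b' i - a' i) / 2 ∧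
        2 * ((b' i - a' i) / 2) ≤ b' i - a' i ∧ b' i - a' i - 1 ≤ 2 * ((b' i - a' i) / 2) := by omega
    have hKi_le : b'' i - a'' i ≤ L' := by rw [hKi]; linarith [hHle i, hℓi2.2.2.2]
    have hKi_ge : (L' : ℤ) < 2 * (b'' i - a'' i) := by rw [hKi]; linarith [hℓi2.1, hℓi2.2.2.2]
    have hKpos : ∀ i', a'' i' < b'' i' := by
      intro i'
      by_cases hi' : i' = i
      · rw [hi']; linarith
      · rw [ha'', hb'', Function.update_of_ne hi', Function.update_of_ne hi']; exact hHpos i'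
    have hKle : ∀ i', b'' i' - a'' i' ≤ L' := by
      intro i'
      by_cases hi' : i' = i
      · rw [hi']; exact hKi_le
      · rw [hKside i' hi', hother_eq i' hi']; exact hHj_le
    have hlowb : ∀ i', (L' : ℤ) < 2 * (b'' i' - a'' i') := by
      intro i'
      by_cases hi' : i' = i
      · rw [hi']; exact hKi_ge
      · rw [hKside i' hi', hother_eq i' hi']; exact hHj_ge
    have hKfat : ∀ i₁ i₂, b'' i₁ - a'' i₁ ≤ 10 * (b'' i₂ - a'' i₂) := by
      intro i₁ i₂
      nlinarith [hlowb i₂, hKle i₁]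
    exact hGB' _ (IcoBox_mem_fatRectangles hKpos hKfat hKle)

end Glauber

end Literature.Probability.LatticeModels

end
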